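import Summits.CriticalPhenomena.CardyFormulaZ2.Theses.CardySectorGap
import Literature.Probability.Percolation.SmirnovSeparatingData
import Literature.Probability.Percolation.UnionJackSeparating

/-!
# Birth skeleton of the crux `GsSeparatingApriori` (route CardySectorGap, item stmt-CriticalPhenomena-17675)

The a-priori (RSW-level) half of Cardy on `G_s`, cut along the seam the tree PROVES for the
triangular lattice (`SmirnovSeparatingData.lean`: (D) ⇐ (D′), McShane interpolation + Claims 22–23):

* `stub_ujSeparatingData` — PERCOLATION (Bollobás–Riordan Lemma 14 with Claims 17–21, proof of
  Claim 22, (37) on open arcs, (40)/(19), transplanted to critical site percolation on the centred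
  square lattice with the route's crude `2δ`-slack events): two systems of discrete separating data
  `IsUJData` on inner/outer orientation-certified 3-marked domains whose CANONICAL separating
  probabilities `ujSepProb` sandwich the crude crossing probability at kept triangles `z∓_δ → d'`.
  Inputs in print: RSW for `G_s`-site (Köhler-Schindler–Tassion 2023; Kesten 1982 self-matching),
  boundary 3-arm estimates; the tree's `tri_exists_discreteApprox` is the template.
* `stub_ujInterpolation` — ANALYSIS (McShane interpolation at scale `ρ_δ → 0`, the `G_s` version of
  the PROVED `smirnov_exists_separatingFamilies_of_separatingData` minus its contour part): discrete
  data ⇒ a continuous `[0,1]`-valued uniformly equicontinuous family on `closure Ω` tracking the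
  data up to `e'(δ) → 0` at every kept triangle, whose subsequential limits have the boundary
  values (37) on the closed arcs.
* `GsSeparatingApriori_of` — kernel-checked composition (real proof: both families interpolated,
  sandwich transferred from the data to the interpolants with error `e + e'⁻ + e'⁺`).
-/

namespace Summit.CriticalPhenomena.CardyFormulaZ2.Cruxes.GsSeparatingApriori.Birth

open scoped Topology
open Filter Set
open Literature.Probability.Percolation Literature.Probability.RandomPlanarGeometry

/-- **Discrete separating data on `G_s`** (the `G_s`/kept-triangle counterpart of the tree's
`IsSeparatingData` WITHOUT its `cauchy` field, which is the other piece `GsContourIdentity`): for the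
conformal rectangle `R`, the turn `ω`, `δ₀ > 0` and 3-marked domains `T_δ` (`0 < δ < δ₀`, `δ` the
route's `z`-frame mesh, the canonical observables being read on the lattice copy of `Z`-mesh `δ√2`):
orientation certificates, covering of compacts, density of the kept-triangle centres in `closure Ω`,
approximate equicontinuity of the canonical separating probabilities on kept triangles (proof of
Claim 22), and the boundary behaviour on the open arcs (proof of Claim 23, (37)).
[cite: BollobasRiordan2006, Ch. 7 §7.2.6 pp. 196–201] -/
structure IsUJData (R : ConformalRectangle) (ω : ℂ) (δ₀ : ℝ) (T : ℝ → MarkedDomain 3) : Prop where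
  cert : ∀ δ ∈ Ioo 0 δ₀, ∃ (a' b' c' : ℂ) (ψ' : ConformalEquiv (T δ).carrier (openTriangle a' b' c')),
    IsEquilateral a' b' c' ∧ triangleTurn a' b' c' = ω ∧ ψ'.HasBoundaryValue ((T δ).pt 0) a' ∧
      ψ'.HasBoundaryValue ((T δ).pt 1) b' ∧ ψ'.HasBoundaryValue ((T δ).pt 2) c'
  cover : ∀ K : Set ℂ, IsCompact K → K ⊆ R.carrier → ∀ᶠ δ in 𝓝[>] (0 : ℝ), K ⊆ (T δ).carrier ∧
    ∀ t : UJFace, (((δ * Real.sqrt 2 : ℝ)) : ℂ) * ujFaceCenter t ∈ K → t ∈ ujFaces (T δ).carrier (δ * Real.sqrt 2)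
  dense : ∃ ε : ℝ → ℝ, Tendsto ε (𝓝[>] 0) (𝓝 0) ∧ ∀ δ ∈ Ioo 0 δ₀, ∀ w ∈ closure R.carrier,
    ∃ t ∈ ujFaces (T δ).carrier (δ * Real.sqrt 2), dist w ((((δ * Real.sqrt 2 : ℝ)) : ℂ) * ujFaceCenter t) ≤ ε δ
  equi : ∀ β > (0 : ℝ), ∃ η > (0 : ℝ), ∀ δ ∈ Ioo 0 δ₀, ∀ (i : Fin 3),
    ∀ t ∈ ujFaces (T δ).carrier (δ * Real.sqrt 2), ∀ t' ∈ ujFaces (T δ).carrier (δ * Real.sqrt 2),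
      dist ((((δ * Real.sqrt 2 : ℝ)) : ℂ) * ujFaceCenter t) ((((δ * Real.sqrt 2 : ℝ)) : ℂ) * ujFaceCenter t') < η →
        |ujSepProb (T δ) (δ * Real.sqrt 2) i t - ujSepProb (T δ) (δ * Real.sqrt 2) i t'| ≤ β
  boundary : ∀ (i : Fin 3), ∀ w ∈ (MarkedDomain.forgetLast R).boundary ''
      Ioo ((MarkedDomain.forgetLast R).mark i) ((MarkedDomain.forgetLast R).nextMark i),
    ∃ ts : ℝ → UJFace, (∀ δ ∈ Ioo 0 δ₀, ts δ ∈ ujFaces (T δ).carrier (δ * Real.sqrt 2)) ∧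
      Tendsto (fun δ => (((δ * Real.sqrt 2 : ℝ)) : ℂ) * ujFaceCenter (ts δ)) (𝓝[>] 0) (𝓝 w) ∧
        Tendsto (fun δ => ujSepProb (T δ) (δ * Real.sqrt 2) i (ts δ)) (𝓝[>] 0) (𝓝 0) ∧
          Tendsto (fun δ => ujSepProb (T δ) (δ * Real.sqrt 2) (i + 1) (ts δ) + ujSepProb (T δ) (δ * Real.sqrt 2) (i + 2) (ts δ))
            (𝓝[>] 0) (𝓝 1)

/-- PERCOLATION stub: existence of discrete `G_s` separating data sandwiching the crude crossing
probability (Bollobás–Riordan Lemma 14, Claims 17–22, (37), (40) for `G_s`). [cite: BollobasRiordan2006, Ch. 7 Lemma 14 p. 184, pp. 196–203] [cite: KohlerSchindlerTassion2023, Thm. 1] -/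
theorem stub_ujSeparatingData : ∀ R : Literature.Probability.RandomPlanarGeometry.ConformalRectangle, let Gs : SimpleGraph Literature.Barriers.CriticalPhenomena.MixedSite := SimpleGraph.fromRel (fun u v => (∃ x y : ℤ × ℤ, u = Sum.inl x ∧ v = Sum.inl y ∧ (x.1 - y.1) ^ 2 + (x.2 - y.2) ^ 2 = 1) ∨ (∃ x f : ℤ × ℤ, u = Sum.inl x ∧ v = Sum.inr f ∧ (x.1 = f.1 ∨ x.1 = f.1 + 1) ∧ (x.2 = f.2 ∨ x.2 = f.2 + 1))); let z : Literature.Barriers.CriticalPhenomena.MixedSite → ℂ := fun u => Sum.elim (fun x : ℤ × ℤ => (((x.1 + x.2 : ℤ) : ℂ) + ((x.2 - x.1 + 1 : ℤ) : ℂ) * Complex.I) / (Real.sqrt 2 : ℂ)) (fun f : ℤ × ℤ => (((f.1 + f.2 + 1 : ℤ) : ℂ) + ((f.2 - f.1 + 1 : ℤ) : ℂ) * Complex.I) / (Real.sqrt 2 : ℂ)) u; let P : unitInterval → MeasureTheory.Measure (Set Literature.Barriers.CriticalPhenomena.MixedSite) := fun q => Literature.Probability.LatticeModels.prodBernoulli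 (Literature.Barriers.CriticalPhenomena.mixedParam q); let cross : ℝ → Set (Set Literature.Barriers.CriticalPhenomena.MixedSite) := fun δ => {ω | ∃ u v, Metric.infDist ((δ : ℂ) * z u) (R.arc 0) ≤ 2 * δ ∧ Metric.infDist ((δ : ℂ) * z v) (R.arc 2) ≤ 2 * δ ∧ ω ∈ Literature.Probability.Percolation.siteConnIn Gs {y | (δ : ℂ) * z y ∈ R.carrier} u v}; ∀ (a b c d : ℂ) (ψ : ConformalEquiv R.carrier (openTriangle a b c)), IsEquilateral a b c → d ∈ openSegment ℝ c a → IsCarlesonMap R a b c d ψ → ∃ δ₀ : ℝ, 0 < δ₀ ∧ ∃ Tm Tp : ℝ → MarkedDomain 3, IsUJData R (triangleTurn a b c) δ₀ Tm ∧ IsUJData R (triangleTurn a b c) δ₀ Tp ∧ ∃ (zm zp : ℝ → UJFace) (e : ℝ → ℝ), (∀ δ ∈ Ioo 0 δ₀, zm δ ∈ ujFaces (Tm δ).carrier (δ * Real.sqrt 2) ∧ zp δ ∈ ujFaces (Tp δ).carrier (δ * Real.sqrt 2) ∧ (((δ * Real.sqrt 2 : ℝ)) : ℂ) * ujFaceCenter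 (zm δ) ∈ R.carrier ∧ (((δ * Real.sqrt 2 : ℝ)) : ℂ) * ujFaceCenter (zp δ) ∈ R.carrier) ∧ Tendsto (fun δ => (((δ * Real.sqrt 2 : ℝ)) : ℂ) * ujFaceCenter (zm δ)) (𝓝[>] 0) (𝓝 (R.pt 3)) ∧ Tendsto (fun δ => (((δ * Real.sqrt 2 : ℝ)) : ℂ) * ujFaceCenter (zp δ)) (𝓝[>] 0) (𝓝 (R.pt 3)) ∧ Tendsto e (𝓝[>] 0) (𝓝 0) ∧ ∀ δ ∈ Ioo 0 δ₀, ujSepProb (Tm δ) (δ * Real.sqrt 2) 1 (zm δ) - e δ ≤ (P Literature.Probability.Percolation.half).real (cross δ) ∧ (P Literature.Probability.Percolation.half).real (cross δ) ≤ ujSepProb (Tp δ) (δ * Real.sqrt 2) 1 (zp δ) + e δ := by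
  sorry

/-- ANALYSIS stub: McShane interpolation of discrete `G_s` separating data (Bollobás–Riordan
pp. 196–201, Claims 22–23 without (36)). [cite: BollobasRiordan2006, Ch. 7 Claims 22–23 pp. 197–201] -/
theorem stub_ujInterpolation : ∀ (R : ConformalRectangle) (ω : ℂ) (δ₀ : ℝ) (T : ℝ → MarkedDomain 3), 0 < δ₀ → IsUJData R ω δ₀ T → ∃ (g : ℝ → Fin 3 → ℂ → ℝ) (e' : ℝ → ℝ), Tendsto e' (𝓝[>] 0) (𝓝 0) ∧ (∀ δ ∈ Ioo 0 δ₀, ∀ i, ContinuousOn (g δ i) (closure R.carrier)) ∧ (∀ δ ∈ Ioo 0 δ₀, ∀ i, ∀ w ∈ closure R.carrier, g δ i w ∈ Icc (0 : ℝ) 1) ∧ (∀ i, ∀ β > (0 : ℝ), ∃ η > (0 : ℝ), ∀ δ ∈ Ioo 0 δ₀, ∀ w ∈ closure R.carrier, ∀ w' ∈ closure R.carrier, dist w w' < η → dist (g δ i w) (g δ i w') < β) ∧ (∀ G : Fin 3 → ℂ → ℝ, IsSeqLimit R δ₀ g G → ∀ i : Fin 3, ∀ w ∈ (MarkedDomain.forgetLast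 R).arc i, G i w = 0 ∧ G (i + 1) w + G (i + 2) w = 1) ∧ (∀ δ ∈ Ioo 0 δ₀, ∀ (i : Fin 3) (t : UJFace), t ∈ ujFaces (T δ).carrier (δ * Real.sqrt 2) → |g δ i ((((δ * Real.sqrt 2 : ℝ)) : ℂ) * ujFaceCenter t) - ujSepProb (T δ) (δ * Real.sqrt 2) i t| ≤ e' δ) := by
  sorry

/-- Composition (hypothesis-free: the registered stubs are used BY NAME): the two stubs give the crux `GsSeparatingApriori` BY NAME. -/
theorem GsSeparatingApriori_of :
    Summit.CriticalPhenomena.CardyFormulaZ2.Theses.CardySectorGap.GsSeparatingApriori := by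
  have h1 := stub_ujSeparatingData
  have h2 := stub_ujInterpolation
  intro R
  dsimp only
  intro a b c d ψ habc hd hψ
  obtain ⟨δ₀, hδ₀, Tm, Tp, hDm, hDp, zm, zp, e, hz, hzm, hzp, he, hsand⟩ := h1 R a b c d ψ habc hd hψ
  obtain ⟨gm, em, hem, hcm, hIm, hEm, hBm, htm⟩ := h2 R (triangleTurn a b c) δ₀ Tm hδ₀ hDm
  obtain ⟨gp, ep, hep, hcp, hIp, hEp, hBp, htp⟩ := h2 R (triangleTurn a b c) δ₀ Tp hδ₀ hDp
  refine ⟨δ₀, hδ₀, gm, gp, ?_, fun δ => (((δ * Real.sqrt 2 : ℝ)) : ℂ) * ujFaceCenter (zm δ),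
    fun δ => (((δ * Real.sqrt 2 : ℝ)) : ℂ) * ujFaceCenter (zp δ), fun δ => e δ + em δ + ep δ,
    fun δ hδ => ⟨(hz δ hδ).2.2.1, (hz δ hδ).2.2.2⟩, hzm, hzp, ?_, ?_⟩
  · intro g hg
    rcases hg with rfl | rfl
    · exact ⟨hcm, hIm, hEm, hBm, Tm, em, hem, hDm.cert, hDm.cover, htm⟩
    · exact ⟨hcp, hIp, hEp, hBp, Tp, ep, hep, hDp.cert, hDp.cover, htp⟩
  · simpa using (he.add hem).add hep
  · intro δ hδ
    obtain ⟨hzm', hzp', -, -⟩ := hz δ hδ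
    have t1 := abs_le.1 (htm δ hδ 1 (zm δ) hzm')
    have t2 := abs_le.1 (htp δ hδ 1 (zp δ) hzp')
    have s := hsand δ hδ
    have hem0 : 0 ≤ em δ := le_trans (abs_nonneg _) (htm δ hδ 1 (zm δ) hzm')
    have hep0 : 0 ≤ ep δ := le_trans (abs_nonneg _) (htp δ hδ 1 (zp δ) hzp')
    constructor
    · linarith [t1.1, t1.2, s.1]
    · linarith [t2.1, t2.2, s.2]

end Summit.CriticalPhenomena.CardyFormulaZ2.Cruxes.GsSeparatingApriori.Birth
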